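import Mathlib
import Literature.Analysis.FluidPDE.TaoEnstrophyLocalisationProofs
import HarnessLib.Audit

/-!
# Crux `EulerZoomLiouville.PowerGaugeEulerLiouville` (stmt-NavierStokesRegularity-19832), line `anchored-budget`, stub C2 — part 1:
# THE GNS EVICTION BUDGET (pure real analysis on `ℝ³`, no fluid mechanics)

Route `EulerZoomLiouville` (NavierStokesRegularity), crux E.  Line `anchored-budget` (ideator ns-idea-11 g4;
`Cruxes/PowerGaugeEulerLiouville/Lines/anchored_budget.lean`), stub C2 `stub_anchoredStarvation`.  The anchored floor transport (C1) pays the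
labels of a blob that escape the ball `B(0,a)` by an EVICTION BUDGET `Φ(s) ≥ ∫_E |u(s)|` over measurable `E ⊆ B(0,a)` of blob size; C2 must
produce such a budget from the gauges.  THIS FILE is the member-free analysis:

* `setLIntegral_enorm_le_of_hasCompactSupport` — for `w ∈ C¹_c(ℝ³;ℝ³)` and measurable `E`:
  `∫_E ‖w‖ ≤ |E|^{5/6} · C · (∫ ‖∇w‖²)^{1/2}` (Hölder `1 ↔ 6` on `E`, `eLpNorm_le_eLpNorm_mul_rpow_measure_univ`, and Gagliardo–Nirenberg–Sobolev
  `MeasureTheory.eLpNorm_le_eLpNorm_fderiv_of_eq_inner` with `p = 2`, `n = 3`, `p* = 6`; `C` = Mathlib's constant);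
* `exists_cutoff` — ONE constant `M` and, for every `a > 0`, a `C¹` cutoff `ψ_a`, `0 ≤ ψ_a ≤ 1`, `ψ_a = 1` on `B(0,a)`, `tsupport ψ_a ⊆ B(0,2a)`,
  `‖∇ψ_a‖ ≤ M/a` (a scaled `ContDiffBump`);
* `lintegral_fderiv_smul_sq_le` — `∫ ‖∇(ψ_a v)‖² ≤ 2 ∫_{B(0,2a)} |∇v|_F² + 2 (M/a)² ∫_{B(0,2a)} ‖v‖²`;
* `eviction_of_cutoff` — the two combined: for `v ∈ C¹(ℝ³;ℝ³)` and measurable `E ⊆ B(0,a)`,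
  `∫_E ‖v‖ ≤ |E|^{5/6} · C · (2 ∫_{B(0,2a)} |∇v|_F² + 2 (M/a)² ∫_{B(0,2a)} ‖v‖²)^{1/2}`.

Parts 2–3 (`…AnchoredBudgetBookkeeping`, `…AnchoredBudgetStarvation`) feed the `E`- and `A`-gauges of a member into this bound on the bulk window
and run the race `(1+ρ)(1−2K) > 1−ρ`.

WHAT THIS IS NOT: not NS regularity, not the crux E — a helper `--supports` stmt-19832 (pure real analysis) for a stratum statement about a
hypothetical Euler zoom-limit class (MODEL lattice; crux 19832 and NS regularity stay OPEN).
[folklore; Gagliardo 1958 / Nirenberg 1959; Mathlib `SobolevInequality`; cite: doi:10.1515/crelle.2008.016 (Crippa–De Lellis 2008), §2–3 for the use]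
-/

noncomputable section

set_option linter.dupNamespace false

open MeasureTheory Set Filter Topology Metric Function
open scoped NNReal ENNReal

namespace Summit.NavierStokesRegularity.NavierStokesRegularity.Theorems.PowerGaugeEulerLiouville.AnchoredBudget

open Literature.Analysis.FluidPDE

/-! ### Gagliardo–Nirenberg–Sobolev eviction -/

/-- **GNS EVICTION.**  There is a constant `C` (Mathlib's Gagliardo–Nirenberg–Sobolev constant of `ℝ³` at `p = 2`) such that for every `C¹`
compactly supported `w : ℝ³ → ℝ³` and every measurable `E`:  `∫_E ‖w‖ ≤ |E|^{5/6} · C · (∫ ‖∇w‖²)^{1/2}` (Hölder on `E` between the exponents `1` and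
`6`, then Sobolev `‖w‖_6 ≤ C ‖∇w‖_2`). [folklore] -/
theorem setLIntegral_enorm_le_of_hasCompactSupport :
    ∃ C : ℝ≥0, ∀ (w : EuclideanSpace ℝ (Fin 3) → EuclideanSpace ℝ (Fin 3)), ContDiff ℝ 1 w → HasCompactSupport w →
      ∀ E : Set (EuclideanSpace ℝ (Fin 3)), MeasurableSet E →
        ∫⁻ x in E, ‖w x‖ₑ ≤ volume E ^ (5 / 6 : ℝ) * C * (∫⁻ x, ‖fderiv ℝ w x‖ₑ ^ 2) ^ (1 / 2 : ℝ) := by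
  refine ⟨eLpNormLESNormFDerivOfEqInnerConst (volume : Measure (EuclideanSpace ℝ (Fin 3))) 2, fun w hw hwc E hE => ?_⟩
  set C : ℝ≥0 := eLpNormLESNormFDerivOfEqInnerConst (volume : Measure (EuclideanSpace ℝ (Fin 3))) 2 with hC
  -- (1) Sobolev: `‖w‖_6 ≤ C ‖∇w‖_2`
  have hfin : Module.finrank ℝ (EuclideanSpace ℝ (Fin 3)) = 3 := by simp
  have hpq : ((6 : ℝ≥0) : ℝ)⁻¹ = ((2 : ℝ≥0) : ℝ)⁻¹ - (Module.finrank ℝ (EuclideanSpace ℝ (Fin 3)) : ℝ)⁻¹ := by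
    rw [hfin]; push_cast; norm_num
  have hgns : eLpNorm w (6 : ℝ≥0) volume ≤ (C : ℝ≥0∞) * eLpNorm (fderiv ℝ w) (2 : ℝ≥0) volume :=
    eLpNorm_le_eLpNorm_fderiv_of_eq_inner (volume : Measure (EuclideanSpace ℝ (Fin 3))) hw hwc (p := 2) (p' := 6)
      (by norm_num) (by rw [hfin]; norm_num) hpq
  have e6 : ((6 : ℝ≥0) : ℝ≥0∞) = 6 := by norm_num
  have e2 : ((2 : ℝ≥0) : ℝ≥0∞) = 2 := by norm_num
  rw [e6, e2] at hgns
  -- (2) Hölder on `E`: `∫_E ‖w‖ ≤ ‖w‖_{6,E} |E|^{5/6} ≤ ‖w‖_6 |E|^{5/6}`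
  have hm : AEStronglyMeasurable w (volume.restrict E) := hw.continuous.aestronglyMeasurable
  have hholder := eLpNorm_le_eLpNorm_mul_rpow_measure_univ (μ := volume.restrict E) (p := 1) (q := 6) (by norm_num) hm
  rw [Measure.restrict_apply_univ] at hholder
  have e : 1 / (1 : ℝ≥0∞).toReal - 1 / (6 : ℝ≥0∞).toReal = (5 / 6 : ℝ) := by norm_num
  rw [e, eLpNorm_one_eq_lintegral_enorm] at hholder
  have hmono : eLpNorm w 6 (volume.restrict E) ≤ eLpNorm w 6 volume := eLpNorm_mono_measure w Measure.restrict_le_self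
  -- (3) `‖∇w‖_2 = (∫ ‖∇w‖²)^{1/2}`
  have h2 : eLpNorm (fderiv ℝ w) 2 volume = (∫⁻ x, ‖fderiv ℝ w x‖ₑ ^ 2) ^ (1 / 2 : ℝ) := by
    rw [eLpNorm_eq_lintegral_rpow_enorm_toReal two_ne_zero ENNReal.ofNat_ne_top, ENNReal.toReal_ofNat]
    congr 1
    refine lintegral_congr fun x => ?_
    rw [← ENNReal.rpow_natCast]
    norm_num
  calc ∫⁻ x in E, ‖w x‖ₑ ≤ eLpNorm w 6 (volume.restrict E) * volume E ^ (5 / 6 : ℝ) := hholder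
    _ ≤ (C : ℝ≥0∞) * eLpNorm (fderiv ℝ w) 2 volume * volume E ^ (5 / 6 : ℝ) := by gcongr; exact hmono.trans hgns
    _ = volume E ^ (5 / 6 : ℝ) * C * (∫⁻ x, ‖fderiv ℝ w x‖ₑ ^ 2) ^ (1 / 2 : ℝ) := by rw [h2]; ring

/-! ### The scaled cutoff -/

/-- **A SCALED CUTOFF FAMILY.**  One constant `M > 0` such that for every `a > 0` there is a `C¹` function `ψ : ℝ³ → [0,1]` with compact support,
`ψ = 1` on `B(0,a)`, `tsupport ψ ⊆ B(0,2a)` and `‖∇ψ(x)‖ ≤ M/a` everywhere (`ψ(x) = φ(x/a)` for a fixed smooth bump `φ`, `= 1` on the closed unit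
ball, supported in the closed ball of radius `3/2`). [folklore] -/
theorem exists_cutoff :
    ∃ M : ℝ, 0 < M ∧ ∀ a : ℝ, 0 < a → ∃ ψ : EuclideanSpace ℝ (Fin 3) → ℝ, ContDiff ℝ 1 ψ ∧ HasCompactSupport ψ ∧
      (∀ x, 0 ≤ ψ x) ∧ (∀ x, ψ x ≤ 1) ∧ (∀ x ∈ ball (0 : EuclideanSpace ℝ (Fin 3)) a, ψ x = 1) ∧
      tsupport ψ ⊆ ball (0 : EuclideanSpace ℝ (Fin 3)) (2 * a) ∧ ∀ x, ‖fderiv ℝ ψ x‖ ≤ M / a := by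
  -- the fixed bump
  let φ : ContDiffBump (0 : EuclideanSpace ℝ (Fin 3)) := ⟨1, 3 / 2, one_pos, by norm_num⟩
  have hφd : ContDiff ℝ 1 φ := φ.contDiff
  have hφc : HasCompactSupport φ := φ.hasCompactSupport
  obtain ⟨M₀, hM₀⟩ := (hφd.continuous_fderiv one_ne_zero).bounded_above_of_compact_support (hφc.fderiv ℝ)
  have hM₀0 : 0 ≤ M₀ := (norm_nonneg _).trans (hM₀ 0)
  refine ⟨M₀ + 1, by linarith, fun a ha => ?_⟩
  -- the scaled cutoff `ψ(x) = φ(x/a)`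
  set L : EuclideanSpace ℝ (Fin 3) →L[ℝ] EuclideanSpace ℝ (Fin 3) := a⁻¹ • ContinuousLinearMap.id ℝ (EuclideanSpace ℝ (Fin 3)) with hL
  have hLx : ∀ x, L x = a⁻¹ • x := fun x => by simp [hL]
  have hnormL : ∀ x, ‖L x‖ = a⁻¹ * ‖x‖ := fun x => by
    rw [hLx, norm_smul, norm_inv, Real.norm_eq_abs, abs_of_pos ha]
  set ψ : EuclideanSpace ℝ (Fin 3) → ℝ := fun x => φ (L x) with hψ
  have hlin : ContDiff ℝ 1 (fun x => L x) := L.contDiff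
  have hψd : ContDiff ℝ 1 ψ := hφd.comp hlin
  have htsupp : tsupport ψ ⊆ ball (0 : EuclideanSpace ℝ (Fin 3)) (2 * a) := by
    -- `support ψ ⊆ closedBall 0 (3a/2)`, a closed set inside the open ball `B(0,2a)`
    have hsupp : support ψ ⊆ closedBall (0 : EuclideanSpace ℝ (Fin 3)) (3 / 2 * a) := by
      intro x hx
      have hx' : L x ∈ support (φ : EuclideanSpace ℝ (Fin 3) → ℝ) := hx
      rw [φ.support_eq, mem_ball, dist_zero_right, hnormL] at hx'
      have h1 : a⁻¹ * ‖x‖ < 3 / 2 := hx'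
      rw [mem_closedBall, dist_zero_right]
      have := (inv_mul_lt_iff₀ ha).1 h1
      linarith
    exact (closure_minimal hsupp isClosed_closedBall).trans (closedBall_subset_ball (by linarith))
  have hψc : HasCompactSupport ψ :=
    HasCompactSupport.of_support_subset_isCompact (isCompact_closedBall (0 : EuclideanSpace ℝ (Fin 3)) (2 * a))
      ((subset_tsupport ψ).trans (htsupp.trans ball_subset_closedBall))
  refine ⟨ψ, hψd, hψc, fun x => φ.nonneg, fun x => φ.le_one, fun x hx => ?_, htsupp, fun x => ?_⟩
  · -- `ψ = 1` on `B(0,a)`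
    apply φ.one_of_mem_closedBall
    rw [mem_closedBall, dist_zero_right, hnormL]
    rw [mem_ball, dist_zero_right] at hx
    have : a⁻¹ * ‖x‖ ≤ 1 := (inv_mul_le_iff₀ ha).2 (by linarith : ‖x‖ ≤ a * 1)
    exact this
  · -- the chain rule: `∇ψ(x) = ∇φ(x/a) ∘ L`
    have hderiv : fderiv ℝ ψ x = (fderiv ℝ φ (L x)).comp L := by
      rw [hψ, fderiv_fun_comp x (hφd.differentiable one_ne_zero _) (hlin.differentiable one_ne_zero _), ContinuousLinearMap.fderiv]
    rw [hderiv]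
    calc ‖(fderiv ℝ φ (L x)).comp L‖ ≤ ‖fderiv ℝ φ (L x)‖ * ‖L‖ := ContinuousLinearMap.opNorm_comp_le _ _
      _ ≤ M₀ * a⁻¹ := by
          gcongr
          · exact hM₀ _
          · rw [hL, norm_smul, norm_inv, Real.norm_eq_abs, abs_of_pos ha]
            exact mul_le_of_le_one_right (by positivity) ContinuousLinearMap.norm_id_le
      _ ≤ (M₀ + 1) / a := by rw [div_eq_mul_inv]; gcongr; linarith

/-! ### The gradient of the cut-off field -/

variable {v : EuclideanSpace ℝ (Fin 3) → EuclideanSpace ℝ (Fin 3)} {ψ : EuclideanSpace ℝ (Fin 3) → ℝ} {a M : ℝ}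

/-- The product rule for `x ↦ ψ(x) • v(x)`: `∇(ψ v)(x) h = ψ(x) ∇v(x) h + (∇ψ(x) h) v(x)`. [folklore] -/
theorem fderiv_smul_apply (hv : ContDiff ℝ 1 v) (hψ : ContDiff ℝ 1 ψ) (x h : EuclideanSpace ℝ (Fin 3)) :
    fderiv ℝ (fun y => ψ y • v y) x h = ψ x • fderiv ℝ v x h + (fderiv ℝ ψ x h) • v x := by
  rw [fderiv_fun_smul (hψ.differentiable one_ne_zero x) (hv.differentiable one_ne_zero x)]
  simp only [add_apply, FunLike.coe_smul, Pi.smul_apply,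
    ContinuousLinearMap.smulRight_apply]

/-- Pointwise: with `0 ≤ ψ ≤ 1` and `‖∇ψ‖ ≤ M/a`, `‖∇(ψ v)(x)‖² ≤ 2 ‖∇v(x)‖² + 2 (M/a)² ‖v(x)‖²`, and `∇(ψ v)(x) = 0` off `tsupport ψ`. [folklore] -/
theorem norm_fderiv_smul_sq_le (hv : ContDiff ℝ 1 v) (hψ : ContDiff ℝ 1 ψ) (h0 : ∀ x, 0 ≤ ψ x) (h1 : ∀ x, ψ x ≤ 1)
    (hM : ∀ x, ‖fderiv ℝ ψ x‖ ≤ M / a) (x : EuclideanSpace ℝ (Fin 3)) :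
    ‖fderiv ℝ (fun y => ψ y • v y) x‖ ^ 2 ≤ 2 * ‖fderiv ℝ v x‖ ^ 2 + 2 * (M / a) ^ 2 * ‖v x‖ ^ 2 := by
  have hMa : 0 ≤ M / a := (norm_nonneg _).trans (hM x)
  have hop : ‖fderiv ℝ (fun y => ψ y • v y) x‖ ≤ ‖fderiv ℝ v x‖ + M / a * ‖v x‖ := by
    refine ContinuousLinearMap.opNorm_le_bound _ (by positivity) fun h => ?_
    rw [fderiv_smul_apply hv hψ]
    calc ‖ψ x • fderiv ℝ v x h + (fderiv ℝ ψ x h) • v x‖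
        ≤ ‖ψ x • fderiv ℝ v x h‖ + ‖(fderiv ℝ ψ x h) • v x‖ := norm_add_le _ _
      _ = |ψ x| * ‖fderiv ℝ v x h‖ + |fderiv ℝ ψ x h| * ‖v x‖ := by rw [norm_smul, norm_smul, Real.norm_eq_abs, Real.norm_eq_abs]
      _ ≤ 1 * (‖fderiv ℝ v x‖ * ‖h‖) + (M / a * ‖h‖) * ‖v x‖ := by
          gcongr
          · rw [abs_of_nonneg (h0 x)]; exact h1 x
          · exact ContinuousLinearMap.le_opNorm _ _
          · exact (Real.norm_eq_abs _ ▸ ContinuousLinearMap.le_opNorm (fderiv ℝ ψ x) h).trans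
              (mul_le_mul_of_nonneg_right (hM x) (norm_nonneg _))
      _ = (‖fderiv ℝ v x‖ + M / a * ‖v x‖) * ‖h‖ := by ring
  have hA : 0 ≤ ‖fderiv ℝ v x‖ := norm_nonneg _
  have hB : 0 ≤ M / a * ‖v x‖ := by positivity
  calc ‖fderiv ℝ (fun y => ψ y • v y) x‖ ^ 2 ≤ (‖fderiv ℝ v x‖ + M / a * ‖v x‖) ^ 2 := by gcongr
    _ ≤ 2 * ‖fderiv ℝ v x‖ ^ 2 + 2 * (M / a) ^ 2 * ‖v x‖ ^ 2 := by nlinarith [sq_nonneg (‖fderiv ℝ v x‖ - M / a * ‖v x‖)]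

/-- Off `tsupport ψ` the cut-off field has zero gradient. [folklore] -/
theorem fderiv_smul_eq_zero_of_notMem (hv : ContDiff ℝ 1 v) (hψ : ContDiff ℝ 1 ψ) {x : EuclideanSpace ℝ (Fin 3)}
    (hx : x ∉ tsupport ψ) : fderiv ℝ (fun y => ψ y • v y) x = 0 := by
  have hψ0 : ψ x = 0 := image_eq_zero_of_notMem_tsupport hx
  have hdψ0 : fderiv ℝ ψ x = 0 := fderiv_of_notMem_tsupport ℝ hx
  ext h i
  rw [fderiv_smul_apply hv hψ, hψ0, hdψ0]
  simp

/-- **THE GRADIENT OF THE CUT-OFF FIELD IN `L²`.**  For `v ∈ C¹`, a cutoff `ψ ∈ C¹`, `0 ≤ ψ ≤ 1`, `tsupport ψ ⊆ B(0,2a)`, `‖∇ψ‖ ≤ M/a`: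
`∫ ‖∇(ψ v)‖² ≤ 2 ∫_{B(0,2a)} |∇v|_F² + 2 (M/a)² ∫_{B(0,2a)} ‖v‖²` (operator norm `≤` Frobenius norm, `sq_opNorm_le_frobeniusNormSq`). [folklore] -/
theorem lintegral_fderiv_smul_sq_le (hv : ContDiff ℝ 1 v) (hψ : ContDiff ℝ 1 ψ) (h0 : ∀ x, 0 ≤ ψ x) (h1 : ∀ x, ψ x ≤ 1)
    (hts : tsupport ψ ⊆ ball (0 : EuclideanSpace ℝ (Fin 3)) (2 * a)) (hM : ∀ x, ‖fderiv ℝ ψ x‖ ≤ M / a) :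
    ∫⁻ x, ‖fderiv ℝ (fun y => ψ y • v y) x‖ₑ ^ 2 ≤
      (2 * ∫⁻ x in ball (0 : EuclideanSpace ℝ (Fin 3)) (2 * a), ENNReal.ofReal (frobeniusNormSq (fderiv ℝ v x))) +
        2 * ENNReal.ofReal ((M / a) ^ 2) * ∫⁻ x in ball (0 : EuclideanSpace ℝ (Fin 3)) (2 * a), ‖v x‖ₑ ^ 2 := by
  set B : Set (EuclideanSpace ℝ (Fin 3)) := ball 0 (2 * a) with hB
  -- the integrand vanishes off `B`
  have hvan : ∫⁻ x, ‖fderiv ℝ (fun y => ψ y • v y) x‖ₑ ^ 2 = ∫⁻ x in B, ‖fderiv ℝ (fun y => ψ y • v y) x‖ₑ ^ 2 := by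
    rw [← lintegral_indicator measurableSet_ball]
    refine lintegral_congr fun x => ?_
    by_cases hx : x ∈ B
    · rw [indicator_of_mem hx]
    · rw [indicator_of_notMem hx, fderiv_smul_eq_zero_of_notMem hv hψ fun h => hx (hts h), ← ofReal_norm, norm_zero,
        ENNReal.ofReal_zero, zero_pow two_ne_zero]
  rw [hvan]
  -- pointwise bound, then split the integral
  have hpt : ∀ x, ‖fderiv ℝ (fun y => ψ y • v y) x‖ₑ ^ 2 ≤
      2 * ENNReal.ofReal (frobeniusNormSq (fderiv ℝ v x)) + 2 * ENNReal.ofReal ((M / a) ^ 2) * ‖v x‖ₑ ^ 2 := by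
    intro x
    have h := norm_fderiv_smul_sq_le hv hψ h0 h1 hM x
    have hF : ‖fderiv ℝ v x‖ ^ 2 ≤ frobeniusNormSq (fderiv ℝ v x) := sq_opNorm_le_frobeniusNormSq _
    have hF0 : 0 ≤ frobeniusNormSq (fderiv ℝ v x) := frobeniusNormSq_nonneg _
    have hm0 : 0 ≤ (M / a) ^ 2 := sq_nonneg _
    have hle : ‖fderiv ℝ (fun y => ψ y • v y) x‖ ^ 2 ≤ 2 * frobeniusNormSq (fderiv ℝ v x) + 2 * (M / a) ^ 2 * ‖v x‖ ^ 2 := by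
      nlinarith
    have e1 : ‖fderiv ℝ (fun y => ψ y • v y) x‖ₑ ^ 2 = ENNReal.ofReal (‖fderiv ℝ (fun y => ψ y • v y) x‖ ^ 2) := by
      rw [← ofReal_norm, ENNReal.ofReal_pow (norm_nonneg _)]
    have e2 : ‖v x‖ₑ ^ 2 = ENNReal.ofReal (‖v x‖ ^ 2) := by rw [← ofReal_norm, ENNReal.ofReal_pow (norm_nonneg _)]
    have e3 : ENNReal.ofReal (2 * frobeniusNormSq (fderiv ℝ v x) + 2 * (M / a) ^ 2 * ‖v x‖ ^ 2) =
        ENNReal.ofReal 2 * ENNReal.ofReal (frobeniusNormSq (fderiv ℝ v x)) +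
          ENNReal.ofReal 2 * ENNReal.ofReal ((M / a) ^ 2) * ENNReal.ofReal (‖v x‖ ^ 2) := by
      rw [ENNReal.ofReal_add (by positivity) (by positivity), ENNReal.ofReal_mul (by positivity),
        ENNReal.ofReal_mul (by positivity), ENNReal.ofReal_mul (by norm_num)]
    rw [e1, e2]
    refine (ENNReal.ofReal_le_ofReal hle).trans (le_of_eq ?_)
    rw [e3]
    simp only [ENNReal.ofReal_ofNat]
  have hmeasF : Measurable fun x => ENNReal.ofReal (frobeniusNormSq (fderiv ℝ v x)) :=
    (continuous_frobeniusNormSq_fderiv hv one_ne_zero).measurable.ennreal_ofReal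
  calc ∫⁻ x in B, ‖fderiv ℝ (fun y => ψ y • v y) x‖ₑ ^ 2
      ≤ ∫⁻ x in B, (2 * ENNReal.ofReal (frobeniusNormSq (fderiv ℝ v x)) + 2 * ENNReal.ofReal ((M / a) ^ 2) * ‖v x‖ₑ ^ 2) :=
        lintegral_mono fun x => hpt x
    _ = (2 * ∫⁻ x in B, ENNReal.ofReal (frobeniusNormSq (fderiv ℝ v x))) +
          2 * ENNReal.ofReal ((M / a) ^ 2) * ∫⁻ x in B, ‖v x‖ₑ ^ 2 := by
        rw [lintegral_add_left' ((hmeasF.const_mul _).aemeasurable), lintegral_const_mul' _ _ ENNReal.ofNat_ne_top,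
          lintegral_const_mul' _ _ (ENNReal.mul_ne_top ENNReal.ofNat_ne_top ENNReal.ofReal_ne_top)]

/-! ### The eviction bound of a `C¹` field from a cutoff -/

/-- **EVICTION FROM A CUTOFF.**  Let `C` be a GNS eviction constant (`setLIntegral_enorm_le_of_hasCompactSupport`) and `ψ` a cutoff of `B(0,a)` inside
`B(0,2a)` with `‖∇ψ‖ ≤ M/a`.  For every `C¹` field `v` and measurable `E ⊆ B(0,a)`:
`∫_E ‖v‖ ≤ |E|^{5/6} · C · (2 ∫_{B(0,2a)} |∇v|_F² + 2 (M/a)² ∫_{B(0,2a)} ‖v‖²)^{1/2}` (on `E`, `v = ψ v`). [folklore] -/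
theorem eviction_of_cutoff {C : ℝ≥0}
    (hC : ∀ (w : EuclideanSpace ℝ (Fin 3) → EuclideanSpace ℝ (Fin 3)), ContDiff ℝ 1 w → HasCompactSupport w →
      ∀ E : Set (EuclideanSpace ℝ (Fin 3)), MeasurableSet E →
        ∫⁻ x in E, ‖w x‖ₑ ≤ volume E ^ (5 / 6 : ℝ) * C * (∫⁻ x, ‖fderiv ℝ w x‖ₑ ^ 2) ^ (1 / 2 : ℝ))
    (hv : ContDiff ℝ 1 v) (hψ : ContDiff ℝ 1 ψ) (hψc : HasCompactSupport ψ) (h0 : ∀ x, 0 ≤ ψ x) (h1 : ∀ x, ψ x ≤ 1)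
    (hone : ∀ x ∈ ball (0 : EuclideanSpace ℝ (Fin 3)) a, ψ x = 1)
    (hts : tsupport ψ ⊆ ball (0 : EuclideanSpace ℝ (Fin 3)) (2 * a)) (hM : ∀ x, ‖fderiv ℝ ψ x‖ ≤ M / a)
    {E : Set (EuclideanSpace ℝ (Fin 3))} (hE : MeasurableSet E) (hEa : E ⊆ ball (0 : EuclideanSpace ℝ (Fin 3)) a) :
    ∫⁻ x in E, ‖v x‖ₑ ≤ volume E ^ (5 / 6 : ℝ) * C *
      ((2 * ∫⁻ x in ball (0 : EuclideanSpace ℝ (Fin 3)) (2 * a), ENNReal.ofReal (frobeniusNormSq (fderiv ℝ v x))) +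
        2 * ENNReal.ofReal ((M / a) ^ 2) * ∫⁻ x in ball (0 : EuclideanSpace ℝ (Fin 3)) (2 * a), ‖v x‖ₑ ^ 2) ^ (1 / 2 : ℝ) := by
  set w : EuclideanSpace ℝ (Fin 3) → EuclideanSpace ℝ (Fin 3) := fun y => ψ y • v y with hw
  have hwd : ContDiff ℝ 1 w := hψ.smul hv
  have hwc : HasCompactSupport w := hψc.smul_right
  have hEw : ∫⁻ x in E, ‖v x‖ₑ = ∫⁻ x in E, ‖w x‖ₑ := by
    refine setLIntegral_congr_fun hE fun x hx => ?_
    rw [hw]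
    simp only [hone x (hEa hx), one_smul]
  rw [hEw]
  calc ∫⁻ x in E, ‖w x‖ₑ ≤ volume E ^ (5 / 6 : ℝ) * C * (∫⁻ x, ‖fderiv ℝ w x‖ₑ ^ 2) ^ (1 / 2 : ℝ) := hC w hwd hwc E hE
    _ ≤ _ := by
        gcongr
        exact lintegral_fderiv_smul_sq_le hv hψ h0 h1 hts hM

end Summit.NavierStokesRegularity.NavierStokesRegularity.Theorems.PowerGaugeEulerLiouville.AnchoredBudget

end
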